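import Summits.AtomisticToContinuum.FouriersLaw.Theorems.BondHeatUncertaintyDefs
import Literature.MathematicalPhysics.KineticTheory.LangevinChainEnergyIdentity

/-!
# Finite-bias Clausius (stub `stub_finiteBiasClausius`), helper 1: the pathwise energy balance

Helper file for crux `stmt-AtomisticToContinuum-9122` (`BondHeatUncertainty.LinearResponseFTUR`), line
`lebesgue-flip-duality`, stub `stub_finiteBiasClausius`. Pure calculus on the pathwise flow
`z = chainFlow x η` of the pinned chain (`LangevinChainSDE.lean`: `z(t) = x + (0, η(t)) + ∫₀ᵗ Y(z(s)) ds`):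

* `clausius_hamiltonian_chainFlow_sub` — for EVERY continuous momentum-noise path `η` and `t ≥ 0`,
  `H(z t) - H(x) = ∑_i (p_i(t)²/2 - p_i(0)²/2 + ∫₀ᵗ p_i ∂_{q_i}H(z s) ds)` (the potential energy is a `C¹`
  function of the `C¹` position path, `q' = p`), and for every site `i` which carries no bath and no
  noise (`bathWeight N i = 0`, `η_i ≡ 0`) the `i`-th summand vanishes (`p_i' = -∂_{q_i}H`);
* `clausius_fwdPath_energy_balance` — hence along the forward path `fwdPath` of the vocabulary file
  (`Theorems/BondHeatUncertaintyDefs.lean`) of an `N ≥ 2` chain the two bath heats read off the raw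
  observable add up to the energy change: `leftHeat i0 obs + rightHeat iN obs = H(X t) - H(z)`
  (registered sub-goal of the stub).

Nothing here closes an item.
-/

noncomputable section

namespace Summit.AtomisticToContinuum.FouriersLaw.Theorems.LinearResponseFTUR

open MeasureTheory Filter Topology Set
open scoped NNReal ENNReal
open Literature.MathematicalPhysics.KineticTheory
open Literature.MathematicalPhysics.KineticTheory.HeatConduction
open Literature.Probability.Process
open Summit.AtomisticToContinuum.FouriersLaw.Theorems.BondHeatUncertainty
open OscillatorChain

variable {N : ℕ}

/-- **Energy balance along the driven flow, site by site.** For the flow `z = chainFlow x η` of the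
pinned chain (`ω₂ > 0`, `lam, β, γ ≥ 0`) driven by a continuous momentum-noise path `η` and `t ≥ 0`:
`H(z t) - H(x) = ∑_i (p_i(t)²/2 - p_i(0)²/2 + ∫₀ᵗ p_i(s) ∂_{q_i}H(z s) ds)`, and the `i`-th summand
vanishes at every site without bath and without noise (`bathWeight N i = 0`, `η_i ≡ 0`). Proof:
`y = z - (0, η)` is `C¹` with `y' = Y(z)`; `(H ∘ y)' = DH(y)·Y(z) = ∑_i (∂_{q_i}H(z) p_i + A_i A_i')`
(`A = y_p`), `∫₀ᵗ A_i A_i' = A_i(t)²/2 - p_i(0)²/2`, `H(z t) = H(y t) + ∑_i (A_i η_i + η_i²/2)` and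
`p_i(t) = A_i(t) + η_i(t)`; at a bathless noiseless site `A_i = p_i` and `A_i' = -∂_{q_i}H(z)`. -/
theorem clausius_hamiltonian_chainFlow_sub {ω₂ lam β γ : ℝ} (hω : 0 < ω₂) (hl : 0 ≤ lam)
    (hβ : 0 ≤ β) (hγ : 0 ≤ γ) (x : PhaseSpace N) {η : ℝ → Fin N → ℝ} (hη : Continuous η)
    {t : ℝ} (ht : 0 ≤ t) :
    ((pinnedChain ω₂ lam β γ).hamiltonian N ((pinnedChain ω₂ lam β γ).chainFlow N x η t) -
        (pinnedChain ω₂ lam β γ).hamiltonian N x =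
      ∑ i, (((pinnedChain ω₂ lam β γ).chainFlow N x η t).2 i ^ 2 / 2 - x.2 i ^ 2 / 2 +
        ∫ s in (0 : ℝ)..t, ((pinnedChain ω₂ lam β γ).chainFlow N x η s).2 i *
          partialQ i ((pinnedChain ω₂ lam β γ).hamiltonian N)
            ((pinnedChain ω₂ lam β γ).chainFlow N x η s))) ∧
    ∀ i : Fin N, bathWeight N i = 0 → (∀ s, η s i = 0) →
      ((pinnedChain ω₂ lam β γ).chainFlow N x η t).2 i ^ 2 / 2 - x.2 i ^ 2 / 2 +
        ∫ s in (0 : ℝ)..t, ((pinnedChain ω₂ lam β γ).chainFlow N x η s).2 i *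
          partialQ i ((pinnedChain ω₂ lam β γ).hamiltonian N)
            ((pinnedChain ω₂ lam β γ).chainFlow N x η s) = 0 := by
  set P := pinnedChain ω₂ lam β γ with hP
  set H := P.hamiltonian N with hHdef
  set Y := P.drift N with hYdef
  set z := P.chainFlow N x η with hzdef
  have hYc : Continuous Y := (pinnedChain_contDiff_drift ω₂ lam β γ N (n := 0)).continuous
  have hzc : Continuous z := pinnedChain_continuous_chainFlow hω hl hβ hγ N x hη
  have hz_eq : ∀ s ∈ Icc 0 t, z s = forcing x η s + ∫ r in (0 : ℝ)..s, Y (z r) :=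
    pinnedChain_isIntegralSolutionOn_chainFlow hω hl hβ hγ N x hη t
  have hHs : ContDiff ℝ 1 H := pinnedChain_contDiff_hamiltonian ω₂ lam β γ N
  have hHd : Differentiable ℝ H := hHs.differentiable one_ne_zero
  have hHfc : Continuous (fderiv ℝ H) := hHs.continuous_fderiv one_ne_zero
  have hQc : ∀ i, Continuous (partialQ i H) := fun i => P.continuous_partialQ_hamiltonian hHs i
  -- `y(t) = x + ∫₀ᵗ Y(z)`, `y' = Y(z)`, `y = z - (0, η)` on `[0, t]`
  set y : ℝ → PhaseSpace N := fun s => x + ∫ r in (0 : ℝ)..s, Y (z r) with hydef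
  have hy_deriv : ∀ s, HasDerivAt y (Y (z s)) s := fun s => by
    have h1 : HasDerivAt (fun u => ∫ r in (0 : ℝ)..u, Y (z r)) (Y (z s)) s :=
      ((hYc.comp hzc).integral_hasStrictDerivAt 0 s).hasDerivAt
    exact h1.const_add x
  have hyc : Continuous y := continuous_iff_continuousAt.2 fun s => (hy_deriv s).continuousAt
  have hy_eq : ∀ s ∈ Icc 0 t, y s = z s - ((0 : Fin N → ℝ), η s) := fun s hs => by
    rw [hz_eq s hs]
    simp only [hydef, forcing]
    abel
  have hy2 : ∀ s ∈ Icc 0 t, ∀ i, (y s).2 i = (z s).2 i - η s i := fun s hs i => by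
    rw [hy_eq s hs]; simp
  have hz_y : ∀ s ∈ Icc 0 t, z s = ((y s).1, (y s).2 + η s) := fun s hs => by
    rw [hy_eq s hs]; ext i <;> simp
  have hy0 : y 0 = x := by simp [hydef]
  -- the momentum coordinates of `y` and their derivatives
  have hsnd : ∀ s, HasDerivAt (fun s => (y s).2) ((Y (z s)).2) s := fun s =>
    (ContinuousLinearMap.snd ℝ (Fin N → ℝ) (Fin N → ℝ)).hasFDerivAt.comp_hasDerivAt s (hy_deriv s)
  have ha : ∀ i s, HasDerivAt (fun s => (y s).2 i) ((Y (z s)).2 i) s := fun i s =>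
    hasDerivAt_pi.1 (hsnd s) i
  have hY2c : ∀ i, Continuous fun s => (Y (z s)).2 i := fun i =>
    (continuous_apply i).comp (continuous_snd.comp (hYc.comp hzc))
  have hA2c : ∀ i, Continuous fun s => (y s).2 i := fun i =>
    (continuous_apply i).comp (continuous_snd.comp hyc)
  have hz2c : ∀ i, Continuous fun s => (z s).2 i := fun i =>
    (continuous_apply i).comp (continuous_snd.comp hzc)
  -- `∫₀ᵗ A_i A_i' = A_i(t)²/2 - p_i(0)²/2`
  have hkin : ∀ i, ∫ s in (0 : ℝ)..t, (y s).2 i * (Y (z s)).2 i =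
      (y t).2 i ^ 2 / 2 - x.2 i ^ 2 / 2 := by
    intro i
    have hd : ∀ s, HasDerivAt (fun s => (y s).2 i ^ 2 / 2) ((y s).2 i * (Y (z s)).2 i) s :=
      fun s => by
      have := ((ha i s).pow 2).div_const 2
      refine this.congr_deriv ?_
      push_cast; ring
    rw [intervalIntegral.integral_eq_sub_of_hasDerivAt (fun s _ => hd s)
      (((hA2c i).mul (hY2c i)).intervalIntegrable _ _), hy0]
  -- the chain rule for `H ∘ y` and the fundamental theorem of calculus
  have hg_deriv : ∀ s, HasDerivAt (fun s => H (y s)) (fderiv ℝ H (y s) (Y (z s))) s := fun s =>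
    (hHd (y s)).hasFDerivAt.comp_hasDerivAt s (hy_deriv s)
  have hg_cont : Continuous fun s => fderiv ℝ H (y s) (Y (z s)) :=
    (hHfc.comp hyc).clm_apply (hYc.comp hzc)
  have hFTC : ∫ s in (0 : ℝ)..t, fderiv ℝ H (y s) (Y (z s)) = H (y t) - H x := by
    rw [intervalIntegral.integral_eq_sub_of_hasDerivAt (fun s _ => hg_deriv s)
      (hg_cont.intervalIntegrable _ _), hy0]
  -- the integrand on `[0, t]`: `DH(y)·Y(z) = ∑_i (p_i ∂_{q_i}H(z) + A_i A_i')`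
  have hintegrand : ∀ s ∈ uIcc 0 t, fderiv ℝ H (y s) (Y (z s)) =
      ∑ i, ((z s).2 i * partialQ i H (z s) + (y s).2 i * (Y (z s)).2 i) := by
    intro s hs
    rw [uIcc_of_le ht] at hs
    rw [P.fderiv_hamiltonian_apply hHd]
    refine Finset.sum_congr rfl fun i _ => ?_
    have h1 : partialQ i H (y s) = partialQ i H (z s) := by
      rw [hz_y s hs]; exact (P.partialQ_hamiltonian_fst (y s) (η s) i).symm
    have h2 : (Y (z s)).1 i = (z s).2 i := rfl
    rw [h1, h2]; ring
  have hIi : ∀ i, IntervalIntegrable (fun s => (z s).2 i * partialQ i H (z s)) volume 0 t := fun i =>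
    ((hz2c i).mul ((hQc i).comp hzc)).intervalIntegrable _ _
  have hIa : ∀ i, IntervalIntegrable (fun s => (y s).2 i * (Y (z s)).2 i) volume 0 t := fun i =>
    ((hA2c i).mul (hY2c i)).intervalIntegrable _ _
  have hsplit : ∫ s in (0 : ℝ)..t, fderiv ℝ H (y s) (Y (z s)) =
      ∑ i, ((∫ s in (0 : ℝ)..t, (z s).2 i * partialQ i H (z s)) +
        ((y t).2 i ^ 2 / 2 - x.2 i ^ 2 / 2)) := by
    rw [intervalIntegral.integral_congr hintegrand,
      intervalIntegral.integral_finsetSum fun i _ => (hIi i).add (hIa i)]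
    refine Finset.sum_congr rfl fun i _ => ?_
    rw [intervalIntegral.integral_add (hIi i) (hIa i), hkin i]
  -- `H(z t) = H(y t) + ∑ (A_i η_i + η_i²/2)` and `p_i(t) = A_i(t) + η_i(t)`
  have hHz : H (z t) = H (y t) + ∑ i, ((y t).2 i * η t i + η t i ^ 2 / 2) := by
    rw [hz_y t ⟨ht, le_rfl⟩]
    exact P.hamiltonian_add_momentum N (y t) (η t)
  have hA : ∀ i, (y t).2 i = (z t).2 i - η t i := fun i => hy2 t ⟨ht, le_rfl⟩ i
  refine ⟨?_, fun i hwi hηi => ?_⟩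
  · have hsum : ∑ i, ((z t).2 i ^ 2 / 2 - x.2 i ^ 2 / 2 +
          ∫ s in (0 : ℝ)..t, (z s).2 i * partialQ i H (z s)) =
        ∑ i, ((∫ s in (0 : ℝ)..t, (z s).2 i * partialQ i H (z s)) +
            ((y t).2 i ^ 2 / 2 - x.2 i ^ 2 / 2)) +
          ∑ i, ((y t).2 i * η t i + η t i ^ 2 / 2) := by
      rw [← Finset.sum_add_distrib]
      refine Finset.sum_congr rfl fun i _ => ?_
      rw [hA i]; ring
    rw [hsum, ← hsplit, hFTC, hHz]
    ring
  · -- a bathless, noiseless site: `A_i = p_i`, `A_i' = -∂_{q_i}H(z)`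
    have hI : ∫ s in (0 : ℝ)..t, (z s).2 i * partialQ i H (z s) =
        -∫ s in (0 : ℝ)..t, (y s).2 i * (Y (z s)).2 i := by
      rw [← intervalIntegral.integral_neg]
      refine intervalIntegral.integral_congr fun s hs => ?_
      rw [uIcc_of_le ht] at hs
      have h1 : (y s).2 i = (z s).2 i := by rw [hy2 s hs i, hηi s, sub_zero]
      have h2 : (Y (z s)).2 i = -partialQ i H (z s) - P.γ * bathWeight N i * (z s).2 i := rfl
      rw [h1, h2, hwi]; ring
    rw [hI, hkin i, hA i, hηi t, sub_zero]
    ring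

/-- **The pathwise energy balance of the forward path** (registered sub-goal of
`stub_finiteBiasClausius`): for the pinned chain (`ω₂ > 0`, `lam, β, γ ≥ 0`) with `N ≥ 2` sites, the
bath sites `i0 = 0 ≠ iN = N - 1`, any bond index `ib`, any temperatures and `t ≥ 0`, along the forward
path `X = fwdPath P N T_L T_R z w` (the flow `solMap` driven by the Brownian pair of `w`, started at `z`)
the two bath heats read off the raw observable add up to the energy change:
`leftHeat i0 (rawObs …) + rightHeat iN (rawObs …) = H(X t) - H(z)`, i.e.
`ΔH = ∑_{b ∈ {0, N-1}} (Δ(p_b²/2) + ∫₀ᵗ p_b ∂_{q_b}H ds)` — the interior sites carry neither bath nor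
noise (`chainNoise` vanishes there), so their summands in `clausius_hamiltonian_chainFlow_sub` vanish. -/
theorem clausius_fwdPath_energy_balance :
    ∀ (ω₂ lam β γ : ℝ), 0 < ω₂ → 0 ≤ lam → 0 ≤ β → 0 ≤ γ →
    ∀ (N : ℕ) (i0 iN ib : Fin N), 2 ≤ N → i0.val = 0 → iN.val = N - 1 →
    ∀ (T_L T_R t : ℝ), 0 ≤ t → ∀ (z : PhaseSpace N) (w : WienerPair),
      leftHeat i0 (rawObs (pinnedChain ω₂ lam β γ) N i0 iN ib t z
          (fwdPath (pinnedChain ω₂ lam β γ) N T_L T_R z w)) +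
        rightHeat iN (rawObs (pinnedChain ω₂ lam β γ) N i0 iN ib t z
          (fwdPath (pinnedChain ω₂ lam β γ) N T_L T_R z w)) =
      (pinnedChain ω₂ lam β γ).hamiltonian N (fwdPath (pinnedChain ω₂ lam β γ) N T_L T_R z w t) -
        (pinnedChain ω₂ lam β γ).hamiltonian N z := by
  intro ω₂ lam β γ hω hl hβ hγ N i0 iN ib hN hi0 hiN T_L T_R t ht z w
  set P := pinnedChain ω₂ lam β γ with hP
  set η : ℝ → Fin N → ℝ :=
    chainNoise N (Real.sqrt (2 * P.γ * T_L)) (Real.sqrt (2 * P.γ * T_R)) (pairPath w) with hηdef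
  have hη : Continuous η := continuous_chainNoise _ _ _
  have hX : fwdPath P N T_L T_R z w = P.chainFlow N z η := rfl
  have hne : i0 ≠ iN := by
    intro h; have := congrArg Fin.val h; omega
  obtain ⟨h1, h2⟩ := clausius_hamiltonian_chainFlow_sub hω hl hβ hγ z hη ht
  have hoff : ∀ c : Fin N, c ≠ i0 ∧ c ≠ iN →
      (P.chainFlow N z η t).2 c ^ 2 / 2 - z.2 c ^ 2 / 2 +
        ∫ s in (0 : ℝ)..t, (P.chainFlow N z η s).2 c *
          partialQ c (P.hamiltonian N) (P.chainFlow N z η s) = 0 := by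
    rintro c ⟨hc0, hcN⟩
    have hc0' : c.val ≠ 0 := fun h => hc0 (Fin.ext (by omega))
    have hcN' : c.val ≠ N - 1 := fun h => hcN (Fin.ext (by omega))
    refine h2 c ?_ fun s => ?_
    · simp [bathWeight, hc0', hcN']
    · simp [hηdef, chainNoise, hc0', hcN']
  rw [hX, h1, Fintype.sum_eq_add i0 iN hne hoff]
  simp only [leftHeat, rightHeat, rawObs, workIntegral]

end Summit.AtomisticToContinuum.FouriersLaw.Theorems.LinearResponseFTUR

end
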